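import Summits.ABC.IUTFork.Conditional.FreyHullThresholdGenuineWild
import Summits.ABC.IUTFork.Conditional.AbcOfSGenuineKLinUniformRows1
import Summits.ABC.IUTFork.Conditional.RefBandsFrey2546698687ThreeCells
import HarnessLib

/-!
# R-W «W:REF-BAND-REST» — `13⁵·19³ + 2·11¹²·1123·76081 = 3³⁸·397`: the hull-level clause S_H (K line) is REFUTED at EVERY genuine Θ-volume datum over `(ratPoint (a/c), l)`
# for EVERY prime `5 ≤ l ≤ 8609207`, `l ≠ 3`, UNIFORMLY in `l`, over the WILD local-type CLASS at the pole `p = 3` (no local-type hypothesis)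

PROOF-ONLY file (D-0012; 0 definitions, 0 `Prop` facts, no instance, no notation) of the abc-iut cell (branch C certificate seat abc-iut-C-cert-1, gen 8;
row «W:REF-BAND-REST», abc-iut-plan C-R107 (b); target named by abc-iut-W-num-5 g5's engine C, STATUS 2026-08-27T07:49:21Z / 08:25:55Z; generator
HOME/staging/C/cert-1/g8/hexrest/hexgen/gen_refW.py). TAKES NO SIDE on [IUTchIII] Cor. 3.12 (S. Mochizuki, *Inter-universal Teichmüller theory III*, Cor. 3.12
p. 173–174; Step (xi-f) p. 184) or on any author; «refuted as typed» ≠ «refuted in print».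
BEFORE THIS FILE (BY NAME): K-line REF for this triple to `l = 321,921` (W-num-6 bands at other members); engine C certifies REF at the wild pole `p = 3` on `[5, 8,609,233]`; INH ∀T from `8,609,239` (W-num-6's band ✓).
THIS FILE: at the WILD pole `p = 3` (`3^38 ∥ abc`, `t = 38`, `3 ∤ t`) abc-iut-w4-d094 g8's engine `GenuineK.not_pilotKummerCompatHull_chosen_triple_of_wildCells`
(`FreyHullThresholdGenuineWild`: fibre point ANY, local type `e = A·l` over abc-iut-W-neg-1's wild CLASS `2 ∣ A`, `15 ∣ A·t`, `A ∣ 3·2·5`, `(5 ∣ t ⇒ A ∣ 3·2)`,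
different bounded by DEDEKIND `δ ≤ e − 1 + [p ∣ A]·e`, inner radius `⌊e/2⌋ + 1`, outer radius at the turning point) needs the top-label cell to FAIL at every class
member; here the class is the SINGLE member `A = 30` (`gcd(15, 38) = 1`), `e = 30l`, `m = 1140`, `δ = 2e − 1`, `r_in = 15l + 1`; per turning-point piece
(a₀ = 4 on 5 ≤ l ≤ 5; a₀ = 5 on 7 ≤ l ≤ 15; a₀ = 6 on 17 ≤ l ≤ 47; a₀ = 7 on 49 ≤ l ≤ 145; a₀ = 8 on 147 ≤ l ≤ 437; a₀ = 9 on 439 ≤ l ≤ 1311; a₀ = 10 on 1313 ≤ l ≤ 3935; a₀ = 11 on 3937 ≤ l ≤ 11809; a₀ = 12 on 11811 ≤ l ≤ 35429; a₀ = 13 on 35431 ≤ l ≤ 106287; a₀ = 14 on 106289 ≤ l ≤ 318863; a₀ = 15 on 318865 ≤ l ≤ 956593; a₀ = 16 on 956595 ≤ l ≤ 2869781; a₀ = 17 on 2869783 ≤ l ≤ 8609233) the failure is a floor-free estimate (`e·⌊X/e⌋ > X − e`) plus a sign check settled by `nlinarith`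
with product hints. Shape: `GenuineK.not_pilotKummerCompatHull_chosen_frey2546698687_three_band` (K line; the engine has no ∀-idèles form). DESK (two engines agree: this seat's exact
top-label scan with `δ = 2e − 1` and W-num-5 g5's engine C): the exact cell inequality holds at every prime of the band and first fails at `l = 8609239`; the inhabited
side (W-num-6's bands) is NOT claimed here. HONEST SCOPE: OUR sharp containers and Dupuy–Hilado's typed (Ind1)/(Ind2); the per-label licence is a STRONGER-THAN-PRINT
sufficient form of Step (xi-f); admissibility / Szpiro-badness / (P6) of `(ratPoint (a/c), l)` and NON-EMPTINESS of the datum type are NOT claimed; nothing about the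
printed inequality, the number-level `Cor22.Cor312AtDatum` or any author's intended hull; typed ≠ proved; instantiated ≠ endorsed; no abc claim.
[cite: Mochizuki2012, IUTchI Ex. 3.2 (iv) p. 71; IUTchIII Cor. 3.12 Step (xi-f) p. 184; IUTchIV Prop. 1.1 p. 9, Prop. 1.2 (i)(ii) p. 10, Thm. 1.10 p. 22, Cor. 2.2 (ii) proof (P5) p. 46]
[cite: DupuyHilado2025, §3.3, §3.4, §4.9, §4.12] [cite: Serre1972, §1.11–§1.12] [claim: Mochizuki2012, status: disputed] for every IUT sentence quoted.
-/

noncomputable section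

open Set Function NumberField IsDedekindDomain

namespace Summit.ABC.IUTFork.Conditional

open Thm311 Thm311.Real Cor312 Cor312Vol Cor312Prov Literature.IUT.LogThetaLattice Literature.IUT.LogVolume
  Literature.IUT.HodgeTheaters Literature.IUT.LogVolume.ThetaData Literature.IUT.LogVolume.Cor22
open Literature.NumberTheory.NumberFields Literature.NumberTheory.GaloisRepresentations.Ultrametric
open Literature.NumberTheory.DiophantineGeometry Literature.NumberTheory.DiophantineGeometry.GenEll Summit.ABC.ABC.Theorems
open Summit.ABC.IUTFork.Repair.RH.HullThresholdExact

/-! ## §2. The band theorem (K-line shape), every prime `5 ≤ l ≤ 8609207`, `l ≠ 3` -/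

/-- Bookkeeping for a prime `5 ≤ l ≤ 8609207`, `l ≠ 3`: `l ≤ 8609233`, odd, and the top label index is admissible. [folklore] -/
private theorem RefBand.frey2546698687_three_aux {l : ℕ} (hl : l.Prime) (hlo : 5 ≤ l) (hhi : l ≤ 8609207) :
    (l ≤ 8609233) ∧ Odd l ∧ (3 : ℕ) ≠ l ∧ (l - 1) / 2 - 1 + 1 ≤ (l - 1) / 2 := by
  refine ⟨?_, hl.odd_of_ne_two (by omega), by omega, ?_⟩
  · omega
  · have h3 : 3 ≤ l := by omega
    omega

/-- **`13⁵·19³ + 2·11¹²·1123·76081 = 3³⁸·397`, every prime `5 ≤ l ≤ 8609207`, `l ≠ 3`: S_H (K line: CHOSEN realising ideles, PINNED reading) FAILS at every genuine Θ-volume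
datum over `(ratPoint (a/c), l)`** — abc-iut-w4-d094 g8's wild engine `GenuineK.not_pilotKummerCompatHull_chosen_triple_of_wildCells` (`FreyHullThresholdGenuineWild`) at `p = 3`,
`t = 38` (class `A = 30`, Dedekind `δ`), top label, `RefBand.wildcells_frey2546698687_three_band`. [cite: Mochizuki2012, IUTchIII Cor. 3.12 Step (xi-f) p. 184] [cite: DupuyHilado2025, §4.9] [claim: Mochizuki2012, status: disputed] -/
theorem GenuineK.not_pilotKummerCompatHull_chosen_frey2546698687_three_band {l : ℕ} (hl : l.Prime) (hlo : 5 ≤ l) (hhi : l ≤ 8609207)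
    (T : Cor22.ThetaVolumeDatumAt (ratPoint (((13 ^ 5 * 19 ^ 3 : ℕ) : ℚ) / (3 ^ 38 * 397 : ℕ))) l) :
    letI := T.instFieldF; letI := T.instNumberFieldF; letI := T.instAlgebraF; letI := T.instFieldK
    letI := T.instNumberFieldK; letI := T.instAlgebraK; letI := T.instFieldFbar; letI := T.instAlgebraFbar
    letI := T.instAlgebraKFbar; letI := T.instIsElliptic
    ∀ (M : Type) [Field M] [NumberField M]
      (archPk : ∀ (j : (thetaIndex (pilotDataOfK T.D T.K)).Label) (vQ : (thetaIndex (pilotDataOfK T.D T.K)).VQ),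
        Set ((logShellsDH (pilotDataOfK T.D T.K) (analyticLogv T.K)).Packet j vQ))
      (archSub : ∀ (j : (thetaIndex (pilotDataOfK T.D T.K)).Label) (v : (thetaIndex (pilotDataOfK T.D T.K)).V),
        Set ((logShellsDH (pilotDataOfK T.D T.K) (analyticLogv T.K)).Packet j ((thetaIndex (pilotDataOfK T.D T.K)).over v)))
      (Ψ : ℤ → ∀ v : (thetaIndex (pilotDataOfK T.D T.K)).V, v ∈ (thetaIndex (pilotDataOfK T.D T.K)).Vbad →
        Set ((logShellsDH (pilotDataOfK T.D T.K) (analyticLogv T.K)).StarPacket v))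
      (act : ℤ → ∀ v : (thetaIndex (pilotDataOfK T.D T.K)).V, v ∈ (thetaIndex (pilotDataOfK T.D T.K)).Vbad →
        (logShellsDH (pilotDataOfK T.D T.K) (analyticLogv T.K)).StarPacket v →
          Module.End ℚ ((logShellsDH (pilotDataOfK T.D T.K) (analyticLogv T.K)).StarPacket v))
      (Mmod : ℤ → ∀ j : (thetaIndex (pilotDataOfK T.D T.K)).LabelStar, Set ((logShellsDH (pilotDataOfK T.D T.K) (analyticLogv T.K)).GlobalPacket j.1))
      (region : ℤ → ∀ j : (thetaIndex (pilotDataOfK T.D T.K)).LabelStar, FinDivisor M → ∀ vQ : (thetaIndex (pilotDataOfK T.D T.K)).VQ,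
        Set ((logShellsDH (pilotDataOfK T.D T.K) (analyticLogv T.K)).Packet j.1 vQ))
      (frobAdm : ℤ → ℤ → ∀ (j : (thetaIndex (pilotDataOfK T.D T.K)).Label) (vQ : (thetaIndex (pilotDataOfK T.D T.K)).VQ),
        Set ((logShellsDH (pilotDataOfK T.D T.K) (analyticLogv T.K)).Packet j vQ) → Prop)
      (frobLogvol : ℤ → ℤ → ∀ (j : (thetaIndex (pilotDataOfK T.D T.K)).Label) (vQ : (thetaIndex (pilotDataOfK T.D T.K)).VQ),
        Set ((logShellsDH (pilotDataOfK T.D T.K) (analyticLogv T.K)).Packet j vQ) → ℝ)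
      (frobΨ : ℤ → ℤ → ∀ v : (thetaIndex (pilotDataOfK T.D T.K)).V, v ∈ (thetaIndex (pilotDataOfK T.D T.K)).Vbad →
        Set ((logShellsDH (pilotDataOfK T.D T.K) (analyticLogv T.K)).StarPacket v))
      (frobMmod : ℤ → ℤ → ∀ j : (thetaIndex (pilotDataOfK T.D T.K)).LabelStar, Set ((logShellsDH (pilotDataOfK T.D T.K) (analyticLogv T.K)).GlobalPacket j.1))
      (unitImage : ℤ → ℤ → ℕ → ∀ (j : (thetaIndex (pilotDataOfK T.D T.K)).Label) (vQ : (thetaIndex (pilotDataOfK T.D T.K)).VQ),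
        Set ((logShellsDH (pilotDataOfK T.D T.K) (analyticLogv T.K)).Packet j vQ))
      (ballImage : ℤ → ℤ → ∀ (j : (thetaIndex (pilotDataOfK T.D T.K)).Label) (vQ : (thetaIndex (pilotDataOfK T.D T.K)).VQ),
        Set ((logShellsDH (pilotDataOfK T.D T.K) (analyticLogv T.K)).Packet j vQ))
      (thetaDiv : ℤ → ℤ → LgpDivisor M (thetaIndex (pilotDataOfK T.D T.K)).lstar)
      (n : ℤ) {HT : Type} {LogLink : HT → HT → Type} {IsFull : ∀ {s t : HT}, LogLink s t → Prop}
      (lat : LGPGaussianLogThetaLattice LogLink IsFull)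
      {Frd : Type} {IsoF : Frd → Frd → Type} {Ob : Frd → Type} {realify : Frd → Frd} {Strip : Type}
      {IsoS : Strip → Strip → Type} {Mv : ∀ v : (thetaIndex (pilotDataOfK T.D T.K)).V, v ∈ (thetaIndex (pilotDataOfK T.D T.K)).Vbad → Type}
      [∀ v h, Monoid (Mv v h)]
      (sig : GlobalLGPFrobenioidSignature (thetaIndex (pilotDataOfK T.D T.K)).lstar (thetaIndex (pilotDataOfK T.D T.K)).V
        (· ∈ (thetaIndex (pilotDataOfK T.D T.K)).Vbad) Frd IsoF Ob realify Strip IsoS Mv)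
      (split : SplittingMonoids Mv) {ObΔ : Type} {N : ∀ v : (thetaIndex (pilotDataOfK T.D T.K)).V, v ∈ (thetaIndex (pilotDataOfK T.D T.K)).Vbad → Type}
      [∀ v h, Monoid (N v h)] (qData : QPilotData ObΔ N)
      (qK : ∀ v : (thetaIndex (pilotDataOfK T.D T.K)).V, v ∈ (thetaIndex (pilotDataOfK T.D T.K)).Vbad →
        Set ((logShellsDH (pilotDataOfK T.D T.K) (analyticLogv T.K)).StarPacket v)),
      ¬ Cor312Vol.PilotKummerCompatHull
          (LatticeSituation.ofShells (logShellsDH (pilotDataOfK T.D T.K) (analyticLogv T.K)) M archPk archSub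
            (summandPiecesPr (pilotDataOfK T.D T.K) (logvAnalytic_analyticLogv (F := T.K))).Adm
            (summandPiecesPr (pilotDataOfK T.D T.K) (logvAnalytic_analyticLogv (F := T.K))).logvol Ψ act Mmod region frobAdm frobLogvol frobΨ
            frobMmod unitImage ballImage thetaDiv)
          (settingPrVolSharp (pilotDataOfK T.D T.K) (logvAnalytic_analyticLogv (F := T.K)) M archPk archSub Ψ act Mmod region n lat sig split qData
            (exists_realising_qIdeles_pilotDataOfK T.D).choose (exists_realising_thetaIdeles_pilotDataOfK T.D).choose
            (exists_realising_qIdeles_pilotDataOfK T.D).choose_spec.1 (exists_realising_qIdeles_pilotDataOfK T.D).choose_spec.2.1)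
          (fun _ => Cor312.Setting.qRegion
            (settingPrVolSharp (pilotDataOfK T.D T.K) (logvAnalytic_analyticLogv (F := T.K)) M archPk archSub Ψ act Mmod region n lat sig split qData
              (exists_realising_qIdeles_pilotDataOfK T.D).choose (exists_realising_thetaIdeles_pilotDataOfK T.D).choose
              (exists_realising_qIdeles_pilotDataOfK T.D).choose_spec.1 (exists_realising_qIdeles_pilotDataOfK T.D).choose_spec.2.1)) qK := by
  obtain ⟨hhi', hodd, hpl, hi⟩ := RefBand.frey2546698687_three_aux hl hlo hhi
  exact GenuineK.not_pilotKummerCompatHull_chosen_triple_of_wildCells isABCTriple_frey2546698687 T ⟨3, by norm_num⟩ (p' := 5)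
    (Or.inl ⟨rfl, rfl⟩) hpl (t := 38) (by norm_num) (by norm_num) (by norm_num) (i := (l - 1) / 2 - 1) hi
    (RefBand.wildcells_frey2546698687_three_band hlo hhi' hodd (by omega))

end Summit.ABC.IUTFork.Conditional

end
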